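import Literature.MathematicalPhysics.QuantumFieldTheory.Balaban1983to89.B1Eq324BenfattoSect5PavementStep
import Literature.MathematicalPhysics.QuantumFieldTheory.Balaban1983to89.B1Eq324BenfattoSect5Termination
import Literature.MathematicalPhysics.QuantumFieldTheory.Balaban1983to89.B1Eq324BenfattoSpecialisation
import HarnessLib

/-!
# `Balaban1983to89.B1Eq324BenfattoSect5PavementChain` — [BenfattoEtAl1978] §5 p. 154 + p. 159: THE `d + 1` DISPLACED PAVEMENT STEPS OF THE PROOF
# OF THE BASIC LEMMA, CHAINED IN DRIFTING FRAMES DOWN TO THE TERMINAL INTEGRAL OF APPENDIX A — the glue between the one-step theorems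
# (`…Sect5PavementStep`), the restriction/translation bookkeeping (`…Sect5Iteration`) and the termination geometry (`…Sect5Termination`)

statement-level skeleton of published theorems with citation tags; proofs where landed; nothing here is a claim about the
Yang–Mills mass gap

WHY THIS MODULE (cell `pub-ymgap`, seat `dag-n08-c` gen 19, INTENT-1; node N08 [Balaban1985UV3]; the [BenfattoEtAl1978] source chain behind
(24)/(58) of [B10] via [B1] (3.24); assembly map `N08-BCG-ASSEMBLY-MAP.md` v1.2 item (4) «layer 3 = the displaced pavements … XL, unassigned»).
Print, p. 154: *"we shall, then, eliminate the boxes ∩ J and repeat the procedure for the region J ∩ Γ₁ with a new pavement, with boxes of the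
same size of the former ones but shifted in location. After d + 1 steps we shall end-up in the trivial case H_J = 0 because we can arrange the
pavements so that (J∩Γ₁)∩Γ₂∩…∩Γ_{d+1} = ∅"*; p. 159: *"Now we study the integral and remark that it has the same structure as (5.12) with J replaced
by Γ̄₁ and b by γb. Hence we can proceed as before choosing a new pavement displaced by b²/2 along the axis 1, say. After (d + 1) steps … we
end up in the free case, i.e. in the case treated by the lemma in Appendix A. Collecting all the errors made in this process (4.7) is proven."*
Sibling seat dag-n08-d typed ONE step for tesserae cornered on `Lℤ^d` (`…PavementStep.pavementStep_of_setIntegral`, its upper twin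
`upperPavementStep_of_setIntegral`), the transport of a displaced pavement to the standard one (`…Iteration.integral_cutoffBoltzmann_translate`),
the separation geometry (`…Termination.not_forall_sub_mem_corridorsBar`), the terminal integral (`…Termination.integral_cutoffBoltzmann_empty`,
Appendix A) and the abstract chaining (`…Termination.exp_sum_mul_le_of_steps`), leaving the DRIVER — the recursion over the `d + 1` data
`(J_k, I_k, A_k, b_k)` in drifting frames, the propagation of the extension convention and of the coefficient bound, the identification of the
survivors, the emptiness of `J_{d+1}`, the terminal Appendix-A bound — to «the assembler» (their NOTES 2026-08-27).  This file IS that driver, for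
arbitrary sequences obeying the four recursion equations (so a consumer discharges them by `rfl` on its own recursion), with the per-box bounds
and the per-box exponents `ℓ_k(□)` left as hypotheses in the set-integral shape of the per-box line's `…PerBoxOnData.perBox_condField` at each
step's STANDARD-position datum; plus the frame invariance of the free truncated expectations that the telescope of the extracted exponents over
the steps (sibling seat dag-n08-b's `…Sect5FreeStep`) needs, and the «clip» of an arbitrary coefficient family of `BasicLemma` to the index range of
(4.5) (extension convention + GLOBAL coefficient bound `≤ coefSup`, the currency of `perBox_condField`).

THE PRINTED TEXT: p. 154 last paragraph and p. 159 last paragraph (quoted above; desk renders `lit-balaban-typer/renders/benfatto1978-cmp59/bcg_p154_s3.png`,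
`bcg_p159_s3.png` via the sibling files `…Sect5Boxes` / `…Sect5PavementStep`).

DICTIONARY.  Step `k` of the chain acts on the datum `(J_k, I_k, A_k, b_k)` («(4.7) for `J_k ⊆ I_k`, family `A_k`, cut-off `b_k`») by FIRST translating
it by `τ_k` — `J_k + τ_k`, `I_k + τ_k`, `A_k(· − τ_k) = shiftCoef A_k (−τ_k)` (the (4.7)-integral is unchanged: `integral_cutoffBoltzmann_frame`,
`P̂₀` translation invariant) — and THEN performing the standard-pavement step of `…PavementStep` with a family of tesserae `B_k ⊇` those meeting
`J_k + τ_k`: the next datum is `J_{k+1} = (J_k + τ_k) ∩ Γ̄₁(B_k)`, `I_{k+1} = I_k + τ_k`, `A_{k+1} = (A_k(· − τ_k))|_{Γ̄₁(B_k)}`, `b_{k+1} = γb_k`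
(lower chain; in the (4.6) chain of the sequel module the cut-off grows, `b_{k+1} = γ⁻¹b_k`).  A site `x ∈ J_0` sits at `x + U_k`, `U_k = Σ_{i<k}τ_i`, in the frame of step `k`,
and survives the first `k` steps iff `x + U_{j+1} ∈ Γ̄₁(B_j)` for all `j < k` (`mem_chain_iff`); print's «(J∩Γ₁)∩Γ₂∩…∩Γ_{d+1} = ∅» is
`…Termination.not_forall_sub_mem_corridorsBar` for the points `s_j = −U_{j+1}`.

WHAT IS PROVED (theorems only; no definition, no named fact, no `sorry`; axioms standard).
* §1 FRAMES: `shiftCoef_shiftCoef_neg`, `hamiltonian_frame`, `cutoffBoltzmann_frame`, ★ `integral_cutoffBoltzmann_frame` (the assembler's direction of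
  `…Iteration.integral_cutoffBoltzmann_translate`), ★ `truncatedExp_hamiltonian_frame` / `cumulantSum_hamiltonian_frame` (the free truncated
  expectations of `H^{A(·−τ)}_{J+τ}` are those of `H^A_J`), `truncatedExp_hamiltonian_restrict` / `cumulantSum_hamiltonian_restrict`,
  `coefSupportedIn_frame`, `abs_shiftCoef_neg_le`.
* §2 CLIP: ★ `exists_coefSupportedIn_clip` — every `a : Coef d` has a clipped twin `a′` supported in `J` (extension convention), GLOBALLY bounded by
  `coefSup s D a J`, equal to `a` on the index range of (4.5), with the same Hamiltonians `H^{a′}_R = H^{a}_R`, `R ⊆ J`.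
* §3 SHIFTS: `sep_of_diagonalShifts` — the diagonal points `s_j = (j+1)·c·𝟙` meet the separation hypothesis of `…Termination` when `(d+1)c ≤ L`.
* §4 LOWER CHAIN: `chain_invariants` (support, global bound, `J_k ⊆ I_k`, `|I_k| = |I_0|` propagate), `pavementStep_frame` (ONE DISPLACED STEP),
  ★★ `lowerPavementChain` (`n` steps: `exp(Σ_{k<n}(−err₅₁₁(k) − err₅₃₄(k) + Σ_{□∈B_k}ℓ_k(□)))·Z_n ≤ Z_0`, `Z_k` the (4.7)-integral of the `k`-th datum),
  `mem_chain_iff` (the survivors), `chain_eq_empty_of_sep` (`J_{d+1} = ∅`), `integral_cutoffBoltzmann_of_eq_empty` (terminal integral = small-field volume),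
  ★★★ `lowerPavementChain_appendixA` — THE (4.7)-SIDE DRIVER: `exp(Σ_{k≤d}(…) − |I|·k₁e^{−k₂b_{d+1}²}) ≤ ∫Π_Δχ̂^{I}_{b}Δ e^{H^A_J} dP̂₀`.
* §5 `le_exp_sum_mul_of_steps` — the chaining lemma of the UPPER direction (`Z_0 ≤ e^{ΣE}·Z_n`); the upper chain itself ((4.6), any `C`, input
  cut-offs `γb_k`, box interiors `b_k` — print's «b replaced by γ⁻¹b») is the sequel module over the sibling seat's `…Sect5Eq536` (v1.1) and
  `…CondTranslation`, not here.
* §6 TELESCOPE: `chain_supported`, ★★ `cumulantSum_chain_telescope` (the per-step differences «free cumulants of the current Hamiltonian in frame `k`»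
  minus «free cumulants of the Hamiltonian handed on, `H_{Γ̄₁(B_k)}`» sum to `cumulantSum P̂₀ H^{A_0}_{J_0} t − cumulantSum P̂₀ H^{A_n}_{J_n} t`),
  `cumulantSum_chain_telescope_of_eq_empty` (`= cumulantSum P̂₀ H^{A_0}_{J_0} t` when `J_n = ∅`) — the bridge from the sibling seat's per-step
  `…Sect5FreeStep.sum_truncatedExp_sub_eq_telescope` to the bracket `[Σ_{k=1}^{t}ℰ̂₀^T(H_J;k)/k!]` of (4.7).

HONEST SCOPE / NOT HERE.  Structural/bookkeeping only: the per-box bounds (the per-box line's `perBox_condField(_appD)`), the values `ℓ_k(□)` / `u_k(□)`,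
the identification of `Σ_kΣ_□ℓ_k(□)` with `cumulantSum (P0 …) (hamiltonian … J) t ± |I|·(…)` (sibling seat's `…Sect5FreeStep` line), the collection of
the errors into `errTerm` with `b* = max{10⁴, γ⁻³b̄}` and the corridor widths, and the (4.6) UPPER chain (any `C`; over `…Sect5Eq536`'s `γ`-thresholded
upper step and `…CondTranslation`) are NOT here.
`BasicLemmaPrinted` stays OPEN; count-neutral for N08; nothing of [Balaban1985UV3] (41)/(47)/(5) is asserted; nothing about d = 4, the continuum,
OS axioms, a mass gap or the Clay problem.
-/

noncomputable section

open Finset MeasureTheory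
open scoped BigOperators

namespace Literature.MathematicalPhysics.QuantumFieldTheory.Balaban1983to89.B1Eq324BenfattoSect5PavementChain

open _root_.MeasureTheory
open Literature.MathematicalPhysics.QuantumFieldTheory.Balaban1983to89.B1Eq324BenfattoLemma
open Literature.MathematicalPhysics.QuantumFieldTheory.Balaban1983to89.B1Eq324BenfattoSect5Boxes
open Literature.MathematicalPhysics.QuantumFieldTheory.Balaban1983to89.B1Eq324BenfattoSect5Eq511
open Literature.MathematicalPhysics.QuantumFieldTheory.Balaban1983to89.B1Eq324BenfattoSect5Eq524
open Literature.MathematicalPhysics.QuantumFieldTheory.Balaban1983to89.B1Eq324BenfattoSect5Eq534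
open Literature.MathematicalPhysics.QuantumFieldTheory.Balaban1983to89.B1Eq324BenfattoSect5Eq515
open Literature.MathematicalPhysics.QuantumFieldTheory.Balaban1983to89.B1Eq324BenfattoSect5Iteration
open Literature.MathematicalPhysics.QuantumFieldTheory.Balaban1983to89.B1Eq324BenfattoSect5Termination
open Literature.MathematicalPhysics.QuantumFieldTheory.Balaban1983to89.B1Eq324BenfattoSect5PavementStep
open Literature.MathematicalPhysics.QuantumFieldTheory.Balaban1983to89.B1Eq324BenfattoTranslation (integral_P0_comp_translate)
open Literature.MathematicalPhysics.QuantumFieldTheory.Balaban1983to89.B1Eq324BenfattoSpecialisation (coefSup_nonneg abs_coef_le_coefSup)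

variable {d : ℕ}

/-! ## §1  Frames: the datum translated by `τ` and its family read back by `−τ` -/

section Frames

variable {α β : ℝ} {s D : ℕ} {κ : ℝ} {a : Coef d}

/-- `(A(· − τ))(· + τ) = A`: shifting the family back and forth is the identity. [cite: BenfattoEtAl1978, (4.5) p.152, p.159] -/
theorem shiftCoef_shiftCoef_neg (a : Coef d) (τ : B1Eq324BenfattoLemma.Site d) : shiftCoef (shiftCoef a (-τ)) τ = a := by
  funext p Δ n
  simp only [shiftCoef, add_neg_cancel_right]

/-- **`H^{A(·−τ)}_{J+τ}(z) = H^A_J(z ∘ (· + τ))`** — the Hamiltonian of the translated datum is the original one read on the translated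
configuration (`…Iteration.hamiltonian_translate`). [cite: BenfattoEtAl1978, (4.5) p.152, p.159] -/
theorem hamiltonian_frame (J : Finset (B1Eq324BenfattoLemma.Site d)) (τ : B1Eq324BenfattoLemma.Site d) (z : B1Eq324BenfattoLemma.Site d → ℝ) :
    hamiltonian s D κ (shiftCoef a (-τ)) (J.image fun x => x + τ) z = hamiltonian s D κ a J fun x => z (x + τ) := by
  rw [hamiltonian_translate, shiftCoef_shiftCoef_neg]

/-- `Π_Δχ̂^{I+τ}_Δ e^{H^{A(·−τ)}_{J+τ}}(z) = (Π_Δχ̂^{I}_Δ e^{H^A_J})(z ∘ (· + τ))`. [cite: BenfattoEtAl1978, (4.7) p.152, p.159] -/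
theorem cutoffBoltzmann_frame (J I : Finset (B1Eq324BenfattoLemma.Site d)) (b : ℝ) (τ : B1Eq324BenfattoLemma.Site d)
    (z : B1Eq324BenfattoLemma.Site d → ℝ) :
    cutoffBoltzmann (hamiltonian s D κ (shiftCoef a (-τ)) (J.image fun x => x + τ)) (I.image fun x => x + τ) b z =
      cutoffBoltzmann (hamiltonian s D κ a J) I b fun x => z (x + τ) := by
  rw [cutoffBoltzmann_translate, shiftCoef_shiftCoef_neg]

/-- **THE (4.7)-INTEGRAL IS FRAME INDEPENDENT** (the assembler's direction of `…Iteration.integral_cutoffBoltzmann_translate`):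
`∫ Π_Δχ̂^{I}_Δ e^{H^A_J} dP̂₀ = ∫ Π_Δχ̂^{I+τ}_Δ e^{H^{A(·−τ)}_{J+τ}} dP̂₀` — «we can proceed as before choosing a new pavement displaced …», p. 159:
a displaced pavement for the datum is the standard pavement for the translated datum. [cite: BenfattoEtAl1978, §5 p.159] -/
theorem integral_cutoffBoltzmann_frame (hα : 0 < α) (hβ : 0 < β) (J I : Finset (B1Eq324BenfattoLemma.Site d)) (b : ℝ)
    (τ : B1Eq324BenfattoLemma.Site d) :
    ∫ z, cutoffBoltzmann (hamiltonian s D κ a J) I b z ∂P0 d α β =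
      ∫ z, cutoffBoltzmann (hamiltonian s D κ (shiftCoef a (-τ)) (J.image fun x => x + τ)) (I.image fun x => x + τ) b z ∂P0 d α β := by
  rw [integral_cutoffBoltzmann_translate hα hβ, shiftCoef_shiftCoef_neg]

/-- **THE FREE TRUNCATED EXPECTATIONS ARE FRAME INDEPENDENT**: `Ê₀^T(H^{A(·−τ)}_{J+τ}; k) = Ê₀^T(H^A_J; k)` — the moments of `H^A_J(z ∘ (· + τ))`
under the translation-invariant `P̂₀` are those of `H^A_J` (`…Translation.integral_P0_comp_translate`).  This is what lets the extracted per-step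
exponents telescope ACROSS the drifting frames against `Σ_k Ê₀^T(H_J;k)/k!`. [cite: BenfattoEtAl1978, (2.7) p.147, (4.7) p.152, §5 p.159] -/
theorem truncatedExp_hamiltonian_frame (hα : 0 < α) (hβ : 0 < β) (J : Finset (B1Eq324BenfattoLemma.Site d)) (τ : B1Eq324BenfattoLemma.Site d)
    (k : ℕ) :
    truncatedExp (P0 d α β) (hamiltonian s D κ (shiftCoef a (-τ)) (J.image fun x => x + τ)) k =
      truncatedExp (P0 d α β) (hamiltonian s D κ a J) k := by
  unfold truncatedExp
  congr 1
  funext r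
  simp only [hamiltonian_frame]
  exact integral_P0_comp_translate hα hβ τ (F := fun z => hamiltonian s D κ a J z ^ r) ((measurable_hamiltonian J).pow_const r)

/-- `Σ_{k≤t} Ê₀^T(H^{A(·−τ)}_{J+τ}; k)/k! = Σ_{k≤t} Ê₀^T(H^A_J; k)/k!`. [cite: BenfattoEtAl1978, (4.7) p.152, §5 p.159] -/
theorem cumulantSum_hamiltonian_frame (hα : 0 < α) (hβ : 0 < β) (J : Finset (B1Eq324BenfattoLemma.Site d)) (τ : B1Eq324BenfattoLemma.Site d)
    (t : ℕ) :
    cumulantSum (P0 d α β) (hamiltonian s D κ (shiftCoef a (-τ)) (J.image fun x => x + τ)) t =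
      cumulantSum (P0 d α β) (hamiltonian s D κ a J) t := by
  unfold cumulantSum
  simp only [truncatedExp_hamiltonian_frame hα hβ]

/-- **Restriction does not change the free truncated expectations of a sub-region**: `Ê^T_μ(H^{A|_R}_T; k) = Ê^T_μ(H^A_T; k)` for `T ⊆ R`
(`…Iteration.hamiltonian_restrictCoef`). [cite: BenfattoEtAl1978, (4.5) p.152, (5.35) p.159] -/
theorem truncatedExp_hamiltonian_restrict (μ : Measure (B1Eq324BenfattoLemma.Site d → ℝ)) {R T : Finset (B1Eq324BenfattoLemma.Site d)}
    (hT : T ⊆ R) (k : ℕ) :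
    truncatedExp μ (hamiltonian s D κ (restrictCoef a R) T) k = truncatedExp μ (hamiltonian s D κ a T) k := by
  unfold truncatedExp
  simp only [hamiltonian_restrictCoef hT]

/-- `Σ_{k≤t} Ê^T_μ(H^{A|_R}_T; k)/k! = Σ_{k≤t} Ê^T_μ(H^A_T; k)/k!` for `T ⊆ R`. [cite: BenfattoEtAl1978, (4.5) p.152, (5.35) p.159] -/
theorem cumulantSum_hamiltonian_restrict (μ : Measure (B1Eq324BenfattoLemma.Site d → ℝ)) {R T : Finset (B1Eq324BenfattoLemma.Site d)}
    (hT : T ⊆ R) (t : ℕ) :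
    cumulantSum μ (hamiltonian s D κ (restrictCoef a R) T) t = cumulantSum μ (hamiltonian s D κ a T) t := by
  unfold cumulantSum
  simp only [truncatedExp_hamiltonian_restrict μ hT]

/-- **The extension convention moves with the frame**: `A` supported in `J` ⇒ `A(· − τ)` supported in `J + τ`. [cite: BenfattoEtAl1978, (5.5) p.154, p.159] -/
theorem coefSupportedIn_frame {J : Finset (B1Eq324BenfattoLemma.Site d)} (hJ : CoefSupportedIn a J) (τ : B1Eq324BenfattoLemma.Site d) :
    CoefSupportedIn (shiftCoef a (-τ)) (J.image fun x => x + τ) := by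
  rw [← coefSupportedIn_shiftCoef_iff, shiftCoef_shiftCoef_neg]
  exact hJ

/-- **The GLOBAL coefficient bound moves with the frame** (pointwise `A(· − τ)` takes values of `A`). [cite: BenfattoEtAl1978, (4.5) p.152, p.159] -/
theorem abs_shiftCoef_neg_le {A : ℝ} (hA : ∀ (p : ℕ) (Δ : Fin p → B1Eq324BenfattoLemma.Site d) (n : Fin p → ℕ), |a p Δ n| ≤ A)
    (τ : B1Eq324BenfattoLemma.Site d) :
    ∀ (p : ℕ) (Δ : Fin p → B1Eq324BenfattoLemma.Site d) (n : Fin p → ℕ), |shiftCoef a (-τ) p Δ n| ≤ A :=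
  abs_shiftCoef_le hA (-τ)

end Frames

/-! ## §2  The clip: an arbitrary coefficient family of `BasicLemma` read under the extension convention with a global bound -/

section Clip

/-- **EVERY COEFFICIENT FAMILY HAS A CLIPPED TWIN** — for `a : Coef d` (the `∀ a` of `BasicLemma`), `J` and the index range of (4.5) (`1 ≦ p ≦ s`,
`Δᵢ ⊂ J`, `n` admissible) there is `a′` with: (i) the extension convention `CoefSupportedIn a′ J` of (5.5) («A^{n}_{Δ} = 0 if some Δᵢ ⊄ J»);
(ii) the GLOBAL bound `|a′ p Δ n| ≤ A ≡ coefSup s D a J` for ALL `p, Δ, n` (the currency of the per-box line's `perBox_condField`); (iii) `a′ = a` on the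
index range; (iv) the same Hamiltonians `H^{a′}_R = H^{a}_R` for every `R ⊆ J` (in particular the (4.7)-integrand and `Σ_k Ê₀^T(H_J;k)/k!` are unchanged).
The witness is `a` times the indicator of the index range. [cite: BenfattoEtAl1978, (4.5) p.152, (5.5) p.154] -/
theorem exists_coefSupportedIn_clip (s D : ℕ) (a : Coef d) (J : Finset (B1Eq324BenfattoLemma.Site d)) :
    ∃ a' : Coef d, CoefSupportedIn a' J ∧
      (∀ (p : ℕ) (Δ : Fin p → B1Eq324BenfattoLemma.Site d) (n : Fin p → ℕ), |a' p Δ n| ≤ coefSup s D a J) ∧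
      (∀ p ∈ Finset.Icc 1 s, ∀ (Δ : Fin p → B1Eq324BenfattoLemma.Site d), (∀ i, Δ i ∈ J) → ∀ n ∈ admissible p D, a' p Δ n = a p Δ n) ∧
      ∀ (κ : ℝ) (R : Finset (B1Eq324BenfattoLemma.Site d)), R ⊆ J → ∀ z : B1Eq324BenfattoLemma.Site d → ℝ,
        hamiltonian s D κ a' R z = hamiltonian s D κ a R z := by
  classical
  refine ⟨fun p Δ n => if p ∈ Finset.Icc 1 s ∧ (∀ i, Δ i ∈ J) ∧ n ∈ admissible p D then a p Δ n else 0, ?_, ?_, ?_, ?_⟩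
  · rintro p Δ n ⟨i, hi⟩
    dsimp only
    rw [if_neg fun h => hi (h.2.1 i)]
  · intro p Δ n
    dsimp only
    split_ifs with h
    · have h' := abs_coef_le_coefSup s D a J h.1 (fun i => (⟨Δ i, h.2.1 i⟩ : J)) h.2.2
      exact h'
    · rw [abs_zero]
      exact coefSup_nonneg s D a J
  · intro p hp Δ hΔ n hn
    dsimp only
    rw [if_pos ⟨hp, hΔ, hn⟩]
  · intro κ R hR z
    unfold hamiltonian
    refine Finset.sum_congr rfl fun p hp => Finset.sum_congr rfl fun Δ _ => Finset.sum_congr rfl fun n hn => ?_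
    dsimp only
    rw [if_pos ⟨hp, fun i => hR (Δ i).2, hn⟩]

end Clip

/-! ## §3  The displacements: diagonal shifts are «suitably displaced» -/

section Shifts

/-- **DIAGONAL DISPLACEMENTS ARE ADMISSIBLE** — print displaces the `k`-th pavement «by b²/2 along the axis 1, say» (p. 159); the tree's termination
criterion (`…Termination.not_forall_sub_mem_corridorsBar`) asks the `d + 1` displacement points to be pairwise `≥ c` apart from each other modulo
`Lℤ` in EVERY coordinate (`c = 2(2w+v)` there).  The diagonal points `s_j = (j+1)·c·(1,…,1)`, `j = 0,…,d`, qualify as soon as `(d+1)·c ≤ L`: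
`c ≤ |(j+1)c − (j′+1)c − qL|` for `j ≠ j′` and every `q ∈ ℤ`. [cite: BenfattoEtAl1978, §5 p.154 «we can arrange the pavements», p.159] -/
theorem sep_of_diagonalShifts {L c : ℕ} (hL : (d + 1) * c ≤ L) :
    ∀ j j' : Fin (d + 1), j ≠ j' → ∀ (_i : Fin d) (q : ℤ),
      (c : ℤ) ≤ |((j : ℕ) + 1 : ℤ) * c - ((j' : ℕ) + 1 : ℤ) * c - q * L| := by
  intro j j' hne _ q
  have hj : (j : ℕ) ≤ d := Nat.lt_succ_iff.mp j.2
  have hj' : (j' : ℕ) ≤ d := Nat.lt_succ_iff.mp j'.2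
  have hjj : (j : ℕ) ≠ (j' : ℕ) := fun h => hne (Fin.ext h)
  have hL' : ((d : ℤ) + 1) * c ≤ L := by exact_mod_cast hL
  have hc0 : (0 : ℤ) ≤ c := by exact_mod_cast Nat.zero_le c
  -- write the difference as `m c − q L` with `0 < |m| ≤ d`
  have hrw : ((j : ℕ) + 1 : ℤ) * c - ((j' : ℕ) + 1 : ℤ) * c - q * L = ((j : ℤ) - (j' : ℤ)) * c - q * L := by
    ring
  rw [hrw]
  rcases lt_trichotomy q 0 with hq | hq | hq
  · -- `q ≤ −1`: `m c − q L ≥ −d c + L ≥ c`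
    have hq1 : q ≤ -1 := by omega
    have h1 : ((j : ℤ) - (j' : ℤ)) * c ≥ -(d : ℤ) * c := by
      have : ((j : ℤ) - (j' : ℤ)) ≥ -(d : ℤ) := by omega
      nlinarith
    have h2 : -(q * (L : ℤ)) ≥ L := by
      have hL0 : (0 : ℤ) ≤ L := by exact_mod_cast Nat.zero_le L
      nlinarith
    refine le_trans ?_ (le_abs_self _)
    nlinarith
  · -- `q = 0`: `|m| c ≥ c`
    subst hq
    rw [zero_mul, sub_zero, abs_mul, abs_of_nonneg hc0]
    have hm : (1 : ℤ) ≤ |(j : ℤ) - (j' : ℤ)| := by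
      have : (j : ℤ) - (j' : ℤ) ≠ 0 := by omega
      exact Int.one_le_abs this
    nlinarith
  · -- `q ≥ 1`: `q L − m c ≥ L − d c ≥ c`
    have hq1 : 1 ≤ q := by omega
    have h1 : ((j : ℤ) - (j' : ℤ)) * c ≤ (d : ℤ) * c := by
      have : ((j : ℤ) - (j' : ℤ)) ≤ (d : ℤ) := by omega
      nlinarith
    have h2 : q * (L : ℤ) ≥ L := by
      have hL0 : (0 : ℤ) ≤ L := by exact_mod_cast Nat.zero_le L
      nlinarith
    refine le_trans ?_ (neg_le_abs _)
    nlinarith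

end Shifts

/-! ## §4  The lower chain: `n` displaced steps, the survivors, termination, the Appendix-A terminal bound -/

section LowerChain

variable {α β : ℝ} {s D : ℕ} {κ : ℝ} {L w v : ℕ} {γ A : ℝ}

/-- **The data of the chain stay admissible**: along the recursion `J_{k+1} = (J_k + τ_k) ∩ Γ̄₁(B_k)`, `I_{k+1} = I_k + τ_k`,
`A_{k+1} = (A_k(· − τ_k))|_{Γ̄₁(B_k)}` the extension convention, the GLOBAL coefficient bound, `J_k ⊆ I_k` and `|I_k| = |I_0|` propagate
(`…Iteration.coefSupportedIn_restrictCoef` / `abs_restrictCoef_le` and §1). [cite: BenfattoEtAl1978, (5.5) p.154, (5.35) p.159] -/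
theorem chain_invariants {Js Is Bs : ℕ → Finset (B1Eq324BenfattoLemma.Site d)} {as : ℕ → Coef d} {τ : ℕ → B1Eq324BenfattoLemma.Site d} {n : ℕ}
    (hsupp : CoefSupportedIn (as 0) (Js 0))
    (hA : ∀ (p : ℕ) (Δ : Fin p → B1Eq324BenfattoLemma.Site d) (nn : Fin p → ℕ), |as 0 p Δ nn| ≤ A) (hJI : Js 0 ⊆ Is 0)
    (hrecJ : ∀ k < n, Js (k + 1) = (Js k).image (fun x => x + τ k) ∩ corridorsBar L w v (Bs k))
    (hrecI : ∀ k < n, Is (k + 1) = (Is k).image fun x => x + τ k)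
    (hreca : ∀ k < n, as (k + 1) = restrictCoef (shiftCoef (as k) (-τ k)) (corridorsBar L w v (Bs k))) :
    ∀ k ≤ n, CoefSupportedIn (as k) (Js k) ∧
      (∀ (p : ℕ) (Δ : Fin p → B1Eq324BenfattoLemma.Site d) (nn : Fin p → ℕ), |as k p Δ nn| ≤ A) ∧
      Js k ⊆ Is k ∧ (Is k).card = (Is 0).card := by
  intro k
  induction k with
  | zero => exact fun _ => ⟨hsupp, hA, hJI, rfl⟩
  | succ k ih =>
    intro hk
    have hk' : k < n := Nat.lt_of_succ_le hk
    obtain ⟨h1, h2, h3, h4⟩ := ih hk'.le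
    refine ⟨?_, ?_, ?_, ?_⟩
    · rw [hreca k hk', hrecJ k hk']
      exact coefSupportedIn_restrictCoef (coefSupportedIn_frame h1 (τ k)) _
    · rw [hreca k hk']
      exact fun p Δ nn => (abs_restrictCoef_le _ _ p Δ nn).trans (abs_shiftCoef_neg_le h2 (τ k) p Δ nn)
    · rw [hrecJ k hk', hrecI k hk']
      exact Finset.inter_subset_left.trans (Finset.image_subset_image h3)
    · rw [hrecI k hk', Finset.card_image_of_injective _ (add_left_injective (τ k)), h4]

/-- **ONE DISPLACED PAVEMENT STEP** — `…PavementStep.pavementStep_of_setIntegral` for the pavement displaced by `−τ`, i.e. the standard pavement for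
the datum translated by `τ` (`integral_cutoffBoltzmann_frame`): for `A` supported in `J ⊆ I` with the global bound `|A| ≤ A`, `L ≥ 1`, `1 ≤ w`, `v ≤ w`,
`B ⊇` the tesserae meeting `J + τ`, `γ ≤ 1 ≤ b`, and per-box lower bounds for the translated datum,
`exp(−err₅₁₁ − err₅₃₄ + Σ_{□∈B}ℓ_□)·∫Π_Δχ̂^{I+τ}_{γb}e^{H^{(A(·−τ))|Γ̄₁}_{(J+τ)∩Γ̄₁}}dP̂₀ ≤ ∫Π_Δχ̂^{I}_{b}e^{H^A_J}dP̂₀`, `err₅₁₁ = s₁Ab^De^{−(ϰ/4)w}|J|`,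
`err₅₃₄ = s₁Ab^D(e^{−(ϰ/4)w}|Γ̄₁(B)| + e^{−(ϰ/4)v}|B|L^d)`. [cite: BenfattoEtAl1978, §5 (5.9)–(5.15) p.155, (5.34)–(5.35) p.159] -/
theorem pavementStep_frame (hα : 0 < α) (hβ : 0 < β) (hκ : 0 < κ) {a : Coef d} {J I : Finset (B1Eq324BenfattoLemma.Site d)}
    (hJ : CoefSupportedIn a J) (hA0 : 0 ≤ A)
    (hA : ∀ (p : ℕ) (Δ : Fin p → B1Eq324BenfattoLemma.Site d) (n : Fin p → ℕ), |a p Δ n| ≤ A)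
    (hJI : J ⊆ I) (hL : 0 < L) (hw : 1 ≤ w) (hv : v ≤ w) (τ : B1Eq324BenfattoLemma.Site d) {B : Finset (B1Eq324BenfattoLemma.Site d)}
    (hB : (J.image fun x => x + τ).image (boxIndex L) ⊆ B) (hγ : γ ≤ 1) {b : ℝ} (hb : 1 ≤ b) (ℓ : B1Eq324BenfattoLemma.Site d → ℝ)
    (hbox : ∀ m ∈ B, ∀ ξ : B1Eq324BenfattoLemma.Site d → ℝ,
      ξ ∈ smallFieldOn (corridors L w B : Set (B1Eq324BenfattoLemma.Site d)) (I.image fun x => x + τ) (γ * b) →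
      Real.exp (ℓ m) * ∫ z in smallFieldOn (shrink L m w : Set (B1Eq324BenfattoLemma.Site d)) (I.image fun x => x + τ) b,
          Real.exp (psi1p s D κ (shiftCoef a (-τ)) L w v m z + psi2 s D κ (shiftCoef a (-τ)) L w m z)
            ∂condField d α β (corridors L w B) ξ
        ≤ ∫ z in smallFieldOn (shrink L m w : Set (B1Eq324BenfattoLemma.Site d)) (I.image fun x => x + τ) b,
          Real.exp (psiBox s D κ (shiftCoef a (-τ)) L w m z) ∂condField d α β (corridors L w B) ξ) :
    Real.exp (-(s1Const s D d κ * A * b ^ D * Real.exp (-(κ / 4 * w)) * J.card)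
        - s1Const s D d κ * A * b ^ D *
          (Real.exp (-(κ / 4 * w)) * (corridorsBar L w v B).card + Real.exp (-(κ / 4 * v)) * (B.card * (L : ℝ) ^ d))
        + ∑ m ∈ B, ℓ m) *
        ∫ z, cutoffBoltzmann (hamiltonian s D κ (restrictCoef (shiftCoef a (-τ)) (corridorsBar L w v B))
          ((J.image fun x => x + τ) ∩ corridorsBar L w v B)) (I.image fun x => x + τ) (γ * b) z ∂P0 d α β
      ≤ ∫ z, cutoffBoltzmann (hamiltonian s D κ a J) I b z ∂P0 d α β := by
  rw [integral_cutoffBoltzmann_frame hα hβ J I b τ]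
  have hcard : ((J.image fun x => x + τ).card : ℝ) = J.card := by
    rw [Finset.card_image_of_injective _ (add_left_injective τ)]
  rw [← hcard]
  exact pavementStep_of_setIntegral hα hβ hκ (coefSupportedIn_frame hJ τ) hA0
    (fun p _ Δ _ n _ => abs_shiftCoef_neg_le hA τ p Δ n) (Finset.image_subset_image hJI) hL hw hv hB hγ hb ℓ hbox

/-- **THE LOWER CHAIN — `n` DISPLACED PAVEMENT STEPS** («we shall … repeat the procedure for the region J ∩ Γ₁ with a new pavement … shifted in location»,
p. 154; «Collecting all the errors made in this process», p. 159).  For ANY sequences of regions `J_k ⊆ I_k`, tesserae families `B_k`, coefficient families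
`A_k`, cut-offs `b_k` and displacements `τ_k` obeying the four recursion equations `J_{k+1} = (J_k + τ_k) ∩ Γ̄₁(B_k)`, `I_{k+1} = I_k + τ_k`,
`A_{k+1} = (A_k(· − τ_k))|_{Γ̄₁(B_k)}`, `b_{k+1} = γb_k` (hypotheses — a consumer defines the sequences by this recursion and discharges them by `rfl`),
with `A_0` supported in `J_0` and globally bounded by `A ≥ 0`, `B_k ⊇` the tesserae meeting `J_k + τ_k`, `1 ≤ b_k`, and per-box lower bounds with exponents
`ℓ_k(□)` at every step (the per-box line's `perBox_condField`, instantiated at the step-`k` datum in standard position):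
`exp(Σ_{k<n}(−err₅₁₁(k) − err₅₃₄(k) + Σ_{□∈B_k}ℓ_k(□)))·∫Π_Δχ̂^{I_n}_{b_n}e^{H^{A_n}_{J_n}}dP̂₀ ≤ ∫Π_Δχ̂^{I_0}_{b_0}e^{H^{A_0}_{J_0}}dP̂₀`
(`pavementStep_frame` chained by `…Termination.exp_sum_mul_le_of_steps`, the invariants by `chain_invariants`).
[cite: BenfattoEtAl1978, §5 p.154, (5.35) p.159 «Collecting all the errors made in this process (4.7) is proven»] -/
theorem lowerPavementChain (hα : 0 < α) (hβ : 0 < β) (hκ : 0 < κ) (hL : 0 < L) (hw : 1 ≤ w) (hv : v ≤ w) (hγ : γ ≤ 1) (hA0 : 0 ≤ A)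
    {Js Is Bs : ℕ → Finset (B1Eq324BenfattoLemma.Site d)} {as : ℕ → Coef d} {bs : ℕ → ℝ} {τ : ℕ → B1Eq324BenfattoLemma.Site d} {n : ℕ}
    (hsupp : CoefSupportedIn (as 0) (Js 0))
    (hA : ∀ (p : ℕ) (Δ : Fin p → B1Eq324BenfattoLemma.Site d) (nn : Fin p → ℕ), |as 0 p Δ nn| ≤ A) (hJI : Js 0 ⊆ Is 0)
    (hrecJ : ∀ k < n, Js (k + 1) = (Js k).image (fun x => x + τ k) ∩ corridorsBar L w v (Bs k))
    (hrecI : ∀ k < n, Is (k + 1) = (Is k).image fun x => x + τ k)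
    (hreca : ∀ k < n, as (k + 1) = restrictCoef (shiftCoef (as k) (-τ k)) (corridorsBar L w v (Bs k)))
    (hrecb : ∀ k < n, bs (k + 1) = γ * bs k) (hb : ∀ k < n, 1 ≤ bs k)
    (hB : ∀ k < n, ((Js k).image fun x => x + τ k).image (boxIndex L) ⊆ Bs k)
    (ℓ : ℕ → B1Eq324BenfattoLemma.Site d → ℝ)
    (hbox : ∀ k < n, ∀ m ∈ Bs k, ∀ ξ : B1Eq324BenfattoLemma.Site d → ℝ,
      ξ ∈ smallFieldOn (corridors L w (Bs k) : Set (B1Eq324BenfattoLemma.Site d)) ((Is k).image fun x => x + τ k) (γ * bs k) →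
      Real.exp (ℓ k m) * ∫ z in smallFieldOn (shrink L m w : Set (B1Eq324BenfattoLemma.Site d)) ((Is k).image fun x => x + τ k) (bs k),
          Real.exp (psi1p s D κ (shiftCoef (as k) (-τ k)) L w v m z + psi2 s D κ (shiftCoef (as k) (-τ k)) L w m z)
            ∂condField d α β (corridors L w (Bs k)) ξ
        ≤ ∫ z in smallFieldOn (shrink L m w : Set (B1Eq324BenfattoLemma.Site d)) ((Is k).image fun x => x + τ k) (bs k),
          Real.exp (psiBox s D κ (shiftCoef (as k) (-τ k)) L w m z) ∂condField d α β (corridors L w (Bs k)) ξ) :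
    Real.exp (∑ k ∈ Finset.range n,
        (-(s1Const s D d κ * A * bs k ^ D * Real.exp (-(κ / 4 * w)) * (Js k).card)
          - s1Const s D d κ * A * bs k ^ D *
            (Real.exp (-(κ / 4 * w)) * (corridorsBar L w v (Bs k)).card + Real.exp (-(κ / 4 * v)) * ((Bs k).card * (L : ℝ) ^ d))
          + ∑ m ∈ Bs k, ℓ k m)) *
        ∫ z, cutoffBoltzmann (hamiltonian s D κ (as n) (Js n)) (Is n) (bs n) z ∂P0 d α β
      ≤ ∫ z, cutoffBoltzmann (hamiltonian s D κ (as 0) (Js 0)) (Is 0) (bs 0) z ∂P0 d α β := by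
  have hinv := chain_invariants hsupp hA hJI hrecJ hrecI hreca (n := n)
  refine exp_sum_mul_le_of_steps (fun k => ∫ z, cutoffBoltzmann (hamiltonian s D κ (as k) (Js k)) (Is k) (bs k) z ∂P0 d α β)
    (fun k => -(s1Const s D d κ * A * bs k ^ D * Real.exp (-(κ / 4 * w)) * (Js k).card)
          - s1Const s D d κ * A * bs k ^ D *
            (Real.exp (-(κ / 4 * w)) * (corridorsBar L w v (Bs k)).card + Real.exp (-(κ / 4 * v)) * ((Bs k).card * (L : ℝ) ^ d))
          + ∑ m ∈ Bs k, ℓ k m) n fun k hk => ?_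
  obtain ⟨h1, h2, h3, -⟩ := hinv k hk.le
  have hstep := pavementStep_frame hα hβ hκ h1 hA0 h2 h3 hL hw hv (τ k) (hB k hk) hγ (hb k hk) (ℓ k) (hbox k hk)
    (s := s) (D := D)
  rw [hrecJ k hk, hrecI k hk, hreca k hk, hrecb k hk]
  exact hstep

/-- **THE SURVIVORS**: along the recursion `J_{k+1} = (J_k + τ_k) ∩ Γ̄₁(B_k)`, a site `y` lies in `J_k` iff `y − U_k ∈ J_0` and
`y − U_k + U_{j+1} ∈ Γ̄₁(B_j)` for every `j < k`, `U_k = Σ_{i<k}τ_i` — «(J∩Γ₁)∩Γ₂∩…» read in the drifting frames. [cite: BenfattoEtAl1978, §5 p.154] -/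
theorem mem_chain_iff {Js Bs : ℕ → Finset (B1Eq324BenfattoLemma.Site d)} {τ : ℕ → B1Eq324BenfattoLemma.Site d} {n : ℕ}
    (hrecJ : ∀ k < n, Js (k + 1) = (Js k).image (fun x => x + τ k) ∩ corridorsBar L w v (Bs k)) :
    ∀ k ≤ n, ∀ y : B1Eq324BenfattoLemma.Site d, y ∈ Js k ↔
      (y - ∑ i ∈ Finset.range k, τ i) ∈ Js 0 ∧
        ∀ j < k, y - ∑ i ∈ Finset.range k, τ i + ∑ i ∈ Finset.range (j + 1), τ i ∈ corridorsBar L w v (Bs j) := by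
  intro k
  induction k with
  | zero =>
    intro _ y
    simp only [Finset.range_zero, Finset.sum_empty, sub_zero, Nat.not_lt_zero, IsEmpty.forall_iff, implies_true, and_true]
  | succ k ih =>
    intro hk y
    have hk' : k < n := Nat.lt_of_succ_le hk
    have hU : ∀ x : B1Eq324BenfattoLemma.Site d, x + τ k - ∑ i ∈ Finset.range (k + 1), τ i = x - ∑ i ∈ Finset.range k, τ i := by
      intro x
      rw [Finset.sum_range_succ]
      abel
    rw [hrecJ k hk', Finset.mem_inter, Finset.mem_image]
    constructor
    · rintro ⟨⟨x, hx, rfl⟩, hΓ⟩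
      have hx' := (ih hk'.le x).mp hx
      refine ⟨?_, fun j hj => ?_⟩
      · rw [hU x]
        exact hx'.1
      · rw [hU x]
        rcases Nat.lt_succ_iff_lt_or_eq.mp hj with hj | rfl
        · exact hx'.2 j hj
        · rw [Finset.sum_range_succ, ← add_assoc, sub_add_cancel]
          exact hΓ
    · rintro ⟨h0, hΓ⟩
      have hy : y - τ k + τ k = y := sub_add_cancel y (τ k)
      refine ⟨⟨y - τ k, (ih hk'.le _).mpr ⟨?_, fun j hj => ?_⟩, hy⟩, ?_⟩
      · rw [← hU (y - τ k), hy]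
        exact h0
      · rw [← hU (y - τ k), hy]
        exact hΓ j (Nat.lt_succ_of_lt hj)
      · have h := hΓ k (Nat.lt_succ_self k)
        rwa [sub_add_cancel] at h

/-- **«(J∩Γ₁)∩Γ₂∩…∩Γ_{d+1} = ∅» — AFTER `d + 1` SUITABLY DISPLACED STEPS NOTHING OF `J` IS LEFT**: if the points `s_j = −U_{j+1}` are pairwise
`≥ 2(2w+v)` apart from each other modulo `Lℤ` in every coordinate (`…Termination.not_forall_sub_mem_corridorsBar`; e.g. diagonal displacements,
`sep_of_diagonalShifts`), then `J_{d+1} = ∅`. [cite: BenfattoEtAl1978, §5 p.154, p.159 «After (d + 1) steps … we end up in the free case»] -/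
theorem chain_eq_empty_of_sep (hL : 0 < L) {Js Bs : ℕ → Finset (B1Eq324BenfattoLemma.Site d)} {τ : ℕ → B1Eq324BenfattoLemma.Site d}
    (hrecJ : ∀ k < d + 1, Js (k + 1) = (Js k).image (fun x => x + τ k) ∩ corridorsBar L w v (Bs k))
    (hsep : ∀ j j' : Fin (d + 1), j ≠ j' → ∀ (i : Fin d) (q : ℤ),
      (2 * (2 * w + v : ℕ) : ℤ) ≤ |(-(∑ i' ∈ Finset.range ((j : ℕ) + 1), τ i')) i - (-(∑ i' ∈ Finset.range ((j' : ℕ) + 1), τ i')) i - q * L|) :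
    Js (d + 1) = ∅ := by
  refine Finset.eq_empty_of_forall_notMem fun y hy => ?_
  have h := (mem_chain_iff hrecJ (d + 1) le_rfl y).mp hy
  refine not_forall_sub_mem_corridorsBar hL (fun j : Fin (d + 1) => -(∑ i' ∈ Finset.range ((j : ℕ) + 1), τ i')) (fun j => Bs j) hsep
    (y - ∑ i ∈ Finset.range (d + 1), τ i) fun j => ?_
  have hj := h.2 j j.2
  rwa [sub_neg_eq_add]

/-- **The terminal integral**: when `J_n = ∅` the (4.7)-integral IS the small-field volume `P̂₀.real(Π_Δχ̂^{I_n}_{b_n})` («the trivial case H_J = 0»,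
`…Termination.integral_cutoffBoltzmann_empty`). [cite: BenfattoEtAl1978, §5 p.154, Appendix A (A.1) p.161] -/
theorem integral_cutoffBoltzmann_of_eq_empty {a : Coef d} {J : Finset (B1Eq324BenfattoLemma.Site d)} (hJ : J = ∅)
    (I : Finset (B1Eq324BenfattoLemma.Site d)) (c : ℝ) :
    ∫ z, cutoffBoltzmann (hamiltonian s D κ a J) I c z ∂P0 d α β = (P0 d α β).real (smallFieldSet I c) := by
  subst hJ
  exact integral_cutoffBoltzmann_empty a I c

/-- **THE (4.7)-SIDE DRIVER — `d + 1` DISPLACED STEPS DOWN TO APPENDIX A**: under the hypotheses of `lowerPavementChain` with `n = d + 1`, displacements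
whose cumulative points `−U_{j+1}` are suitably separated (`chain_eq_empty_of_sep`), `I_0 ≠ ∅`, and the Lemma of Appendix A as displayed numbers
`(b̄, k₁, k₂)` with their property (the tree's `…AppendixA.appendixALemma_of_pos`, to be `obtain`ed once by the consumer) at the terminal cut-off
`b_{d+1} > b̄`:  `exp(Σ_{k≤d}(−err₅₁₁(k) − err₅₃₄(k) + Σ_{□∈B_k}ℓ_k(□)) − |I_0|·k₁e^{−k₂b_{d+1}²}) ≤ ∫Π_Δχ̂^{I_0}_{b_0}e^{H^{A_0}_{J_0}}dP̂₀` — print's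
«After (d + 1) steps … we end up in the free case, i.e. in the case treated by the lemma in Appendix A. Collecting all the errors made in this process
(4.7) is proven» with the per-box exponents and errors still displayed. [cite: BenfattoEtAl1978, §5 p.154, p.159; Appendix A (A.1)–(A.2) p.161] -/
theorem lowerPavementChain_appendixA (hα : 0 < α) (hβ : 0 < β) (hκ : 0 < κ) (hL : 0 < L) (hw : 1 ≤ w) (hv : v ≤ w) (hγ : γ ≤ 1)
    (hA0 : 0 ≤ A)
    {Js Is Bs : ℕ → Finset (B1Eq324BenfattoLemma.Site d)} {as : ℕ → Coef d} {bs : ℕ → ℝ} {τ : ℕ → B1Eq324BenfattoLemma.Site d}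
    (hsupp : CoefSupportedIn (as 0) (Js 0))
    (hA : ∀ (p : ℕ) (Δ : Fin p → B1Eq324BenfattoLemma.Site d) (nn : Fin p → ℕ), |as 0 p Δ nn| ≤ A) (hJI : Js 0 ⊆ Is 0)
    (hrecJ : ∀ k < d + 1, Js (k + 1) = (Js k).image (fun x => x + τ k) ∩ corridorsBar L w v (Bs k))
    (hrecI : ∀ k < d + 1, Is (k + 1) = (Is k).image fun x => x + τ k)
    (hreca : ∀ k < d + 1, as (k + 1) = restrictCoef (shiftCoef (as k) (-τ k)) (corridorsBar L w v (Bs k)))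
    (hrecb : ∀ k < d + 1, bs (k + 1) = γ * bs k) (hb : ∀ k < d + 1, 1 ≤ bs k)
    (hB : ∀ k < d + 1, ((Js k).image fun x => x + τ k).image (boxIndex L) ⊆ Bs k)
    (ℓ : ℕ → B1Eq324BenfattoLemma.Site d → ℝ)
    (hbox : ∀ k < d + 1, ∀ m ∈ Bs k, ∀ ξ : B1Eq324BenfattoLemma.Site d → ℝ,
      ξ ∈ smallFieldOn (corridors L w (Bs k) : Set (B1Eq324BenfattoLemma.Site d)) ((Is k).image fun x => x + τ k) (γ * bs k) →
      Real.exp (ℓ k m) * ∫ z in smallFieldOn (shrink L m w : Set (B1Eq324BenfattoLemma.Site d)) ((Is k).image fun x => x + τ k) (bs k),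
          Real.exp (psi1p s D κ (shiftCoef (as k) (-τ k)) L w v m z + psi2 s D κ (shiftCoef (as k) (-τ k)) L w m z)
            ∂condField d α β (corridors L w (Bs k)) ξ
        ≤ ∫ z in smallFieldOn (shrink L m w : Set (B1Eq324BenfattoLemma.Site d)) ((Is k).image fun x => x + τ k) (bs k),
          Real.exp (psiBox s D κ (shiftCoef (as k) (-τ k)) L w m z) ∂condField d α β (corridors L w (Bs k)) ξ)
    (hsep : ∀ j j' : Fin (d + 1), j ≠ j' → ∀ (i : Fin d) (q : ℤ),
      (2 * (2 * w + v : ℕ) : ℤ) ≤ |(-(∑ i' ∈ Finset.range ((j : ℕ) + 1), τ i')) i - (-(∑ i' ∈ Finset.range ((j' : ℕ) + 1), τ i')) i - q * L|)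
    {bbar k₁ k₂ : ℝ}
    (hAppA : ∀ c : ℝ, bbar < c → ∀ I' : Finset (B1Eq324BenfattoLemma.Site d), I'.Nonempty →
      Real.exp (-((I'.card : ℝ) * (k₁ * Real.exp (-(k₂ * c ^ 2))))) ≤ (P0 d α β).real (smallFieldSet I' c))
    (hI0 : (Is 0).Nonempty) (hbbar : bbar < bs (d + 1)) :
    Real.exp (∑ k ∈ Finset.range (d + 1),
        (-(s1Const s D d κ * A * bs k ^ D * Real.exp (-(κ / 4 * w)) * (Js k).card)
          - s1Const s D d κ * A * bs k ^ D *
            (Real.exp (-(κ / 4 * w)) * (corridorsBar L w v (Bs k)).card + Real.exp (-(κ / 4 * v)) * ((Bs k).card * (L : ℝ) ^ d))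
          + ∑ m ∈ Bs k, ℓ k m)
        - (Is 0).card * (k₁ * Real.exp (-(k₂ * bs (d + 1) ^ 2)))) ≤
      ∫ z, cutoffBoltzmann (hamiltonian s D κ (as 0) (Js 0)) (Is 0) (bs 0) z ∂P0 d α β := by
  have hchain := lowerPavementChain hα hβ hκ hL hw hv hγ hA0 hsupp hA hJI hrecJ hrecI hreca hrecb hb hB ℓ hbox (s := s) (D := D)
  have hinv := chain_invariants hsupp hA hJI hrecJ hrecI hreca (d + 1) le_rfl
  have hJe : Js (d + 1) = ∅ := chain_eq_empty_of_sep hL hrecJ hsep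
  have hIne : (Is (d + 1)).Nonempty := by
    rw [← Finset.card_pos, hinv.2.2.2]
    exact Finset.card_pos.mpr hI0
  have hterm : Real.exp (-(((Is 0).card : ℝ) * (k₁ * Real.exp (-(k₂ * bs (d + 1) ^ 2))))) ≤
      ∫ z, cutoffBoltzmann (hamiltonian s D κ (as (d + 1)) (Js (d + 1))) (Is (d + 1)) (bs (d + 1)) z ∂P0 d α β := by
    rw [integral_cutoffBoltzmann_of_eq_empty hJe, ← hinv.2.2.2]
    exact hAppA _ hbbar _ hIne
  rw [sub_eq_add_neg, Real.exp_add]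
  exact (mul_le_mul_of_nonneg_left hterm (Real.exp_pos _).le).trans hchain

end LowerChain

/-! ## §5  Chaining in the upper direction (the (4.6) chain over `…Sect5Eq536` is the sequel module) -/

section UpperChain

/-- **Chaining upper steps**: if `Z_k ≤ e^{E_k}·Z_{k+1}` for every `k < n`, then `Z_0 ≤ e^{Σ_{k<n}E_k}·Z_n` (the mirror image of
`…Termination.exp_sum_mul_le_of_steps`). [cite: BenfattoEtAl1978, §5 (5.36) p.159] -/
theorem le_exp_sum_mul_of_steps (Z E : ℕ → ℝ) :
    ∀ n : ℕ, (∀ k < n, Z k ≤ Real.exp (E k) * Z (k + 1)) → Z 0 ≤ Real.exp (∑ k ∈ Finset.range n, E k) * Z n := by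
  intro n
  induction n with
  | zero =>
    intro _
    simp
  | succ n ih =>
    intro h
    rw [Finset.sum_range_succ, Real.exp_add]
    calc Z 0 ≤ Real.exp (∑ k ∈ Finset.range n, E k) * Z n := ih fun k hk => h k (Nat.lt_succ_of_lt hk)
      _ ≤ Real.exp (∑ k ∈ Finset.range n, E k) * (Real.exp (E n) * Z (n + 1)) :=
        mul_le_mul_of_nonneg_left (h n (Nat.lt_succ_self n)) (Real.exp_pos _).le
      _ = _ := by ring

end UpperChain

/-! ## §6  The free cumulants telescope across the drifting frames -/

section Telescope

variable {α β : ℝ} {s D : ℕ} {κ : ℝ} {L w v : ℕ}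

/-- The extension convention propagates along the chain (the support half of `chain_invariants`, with no bound and no `I_k` needed).
[cite: BenfattoEtAl1978, (5.5) p.154, (5.35) p.159] -/
theorem chain_supported {Js Bs : ℕ → Finset (B1Eq324BenfattoLemma.Site d)} {as : ℕ → Coef d} {τ : ℕ → B1Eq324BenfattoLemma.Site d} {n : ℕ}
    (hsupp : CoefSupportedIn (as 0) (Js 0))
    (hrecJ : ∀ k < n, Js (k + 1) = (Js k).image (fun x => x + τ k) ∩ corridorsBar L w v (Bs k))
    (hreca : ∀ k < n, as (k + 1) = restrictCoef (shiftCoef (as k) (-τ k)) (corridorsBar L w v (Bs k))) :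
    ∀ k ≤ n, CoefSupportedIn (as k) (Js k) := by
  intro k
  induction k with
  | zero => exact fun _ => hsupp
  | succ k ih =>
    intro hk
    have hk' : k < n := Nat.lt_of_succ_le hk
    rw [hreca k hk', hrecJ k hk']
    exact coefSupportedIn_restrictCoef (coefSupportedIn_frame (ih hk'.le) (τ k)) _

/-- **THE FREE CUMULANTS OF THE DATA TELESCOPE ACROSS THE `n` STEPS** — in the frame of step `k` the current Hamiltonian `H^{A_k(·−τ_k)}_{J_k+τ_k}` has the
free truncated expectations of `H^{A_k}_{J_k}` (§1, `P̂₀` translation invariant) and the Hamiltonian handed on, `H^{A_k(·−τ_k)}_{Γ̄₁(B_k)}` (the extension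
convention: `= H^{A_k(·−τ_k)}_{(J_k+τ_k)∩Γ̄₁(B_k)} = H^{A_{k+1}}_{J_{k+1}}` read before restricting the family), those of `H^{A_{k+1}}_{J_{k+1}}`; hence
`Σ_{k<n}[Σ_{j≤t}Ê₀^T(H^{A_k(·−τ_k)}_{J_k+τ_k};j)/j! − Σ_{j≤t}Ê₀^T(H^{A_k(·−τ_k)}_{Γ̄₁(B_k)};j)/j!] = Σ_{j≤t}Ê₀^T(H^{A_0}_{J_0};j)/j! − Σ_{j≤t}Ê₀^T(H^{A_n}_{J_n};j)/j!`
— the identity behind «Collecting all the errors made in this process (4.7) is proven» that lets the per-step free-cumulant differences of the sibling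
seat's `…Sect5FreeStep.sum_truncatedExp_sub_eq_telescope` add up to the `[Σ_{k=1}^{t}ℰ̂₀^T(H_J;k)/k!]` of (4.7). [cite: BenfattoEtAl1978, (4.7) p.152, §5 (5.35) p.159] -/
theorem cumulantSum_chain_telescope (hα : 0 < α) (hβ : 0 < β)
    {Js Bs : ℕ → Finset (B1Eq324BenfattoLemma.Site d)} {as : ℕ → Coef d} {τ : ℕ → B1Eq324BenfattoLemma.Site d} {n : ℕ}
    (hsupp : CoefSupportedIn (as 0) (Js 0))
    (hrecJ : ∀ k < n, Js (k + 1) = (Js k).image (fun x => x + τ k) ∩ corridorsBar L w v (Bs k))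
    (hreca : ∀ k < n, as (k + 1) = restrictCoef (shiftCoef (as k) (-τ k)) (corridorsBar L w v (Bs k))) (t : ℕ) :
    ∑ k ∈ Finset.range n,
        (cumulantSum (P0 d α β) (hamiltonian s D κ (shiftCoef (as k) (-τ k)) ((Js k).image fun x => x + τ k)) t
          - cumulantSum (P0 d α β) (hamiltonian s D κ (shiftCoef (as k) (-τ k)) (corridorsBar L w v (Bs k))) t)
      = cumulantSum (P0 d α β) (hamiltonian s D κ (as 0) (Js 0)) t - cumulantSum (P0 d α β) (hamiltonian s D κ (as n) (Js n)) t := by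
  have hs := chain_supported hsupp hrecJ hreca (n := n)
  rw [← Finset.sum_range_sub' (fun k => cumulantSum (P0 d α β) (hamiltonian s D κ (as k) (Js k)) t) n]
  refine Finset.sum_congr rfl fun k hk => ?_
  have hk' : k < n := Finset.mem_range.mp hk
  have hsk : CoefSupportedIn (shiftCoef (as k) (-τ k)) ((Js k).image fun x => x + τ k) := coefSupportedIn_frame (hs k hk'.le) (τ k)
  have hcur : cumulantSum (P0 d α β) (hamiltonian s D κ (shiftCoef (as k) (-τ k)) ((Js k).image fun x => x + τ k)) t
      = cumulantSum (P0 d α β) (hamiltonian s D κ (as k) (Js k)) t := cumulantSum_hamiltonian_frame hα hβ (Js k) (τ k) t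
  have hnext : cumulantSum (P0 d α β) (hamiltonian s D κ (shiftCoef (as k) (-τ k)) (corridorsBar L w v (Bs k))) t
      = cumulantSum (P0 d α β) (hamiltonian s D κ (as (k + 1)) (Js (k + 1))) t := by
    rw [hreca k hk', hrecJ k hk', cumulantSum_hamiltonian_restrict (P0 d α β) Finset.inter_subset_right]
    unfold cumulantSum truncatedExp
    simp only [hamiltonian_inter_eq hsk (corridorsBar L w v (Bs k)), Finset.inter_comm]
  rw [hcur, hnext]

/-- **At termination the telescope closes on (4.7)'s bracket**: if `J_n = ∅` (e.g. `n = d + 1` with suitably displaced pavements, `chain_eq_empty_of_sep`)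
the per-step free-cumulant differences add up to `Σ_{j≤t}Ê₀^T(H^{A_0}_{J_0};j)/j!` exactly (`H_∅ = 0` has vanishing cumulants,
`…Specialisation.cumulantSum_zero`). [cite: BenfattoEtAl1978, (4.7) p.152, §5 p.154, p.159] -/
theorem cumulantSum_chain_telescope_of_eq_empty (hα : 0 < α) (hβ : 0 < β)
    {Js Bs : ℕ → Finset (B1Eq324BenfattoLemma.Site d)} {as : ℕ → Coef d} {τ : ℕ → B1Eq324BenfattoLemma.Site d} {n : ℕ}
    (hsupp : CoefSupportedIn (as 0) (Js 0))
    (hrecJ : ∀ k < n, Js (k + 1) = (Js k).image (fun x => x + τ k) ∩ corridorsBar L w v (Bs k))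
    (hreca : ∀ k < n, as (k + 1) = restrictCoef (shiftCoef (as k) (-τ k)) (corridorsBar L w v (Bs k))) (hJn : Js n = ∅) (t : ℕ) :
    ∑ k ∈ Finset.range n,
        (cumulantSum (P0 d α β) (hamiltonian s D κ (shiftCoef (as k) (-τ k)) ((Js k).image fun x => x + τ k)) t
          - cumulantSum (P0 d α β) (hamiltonian s D κ (shiftCoef (as k) (-τ k)) (corridorsBar L w v (Bs k))) t)
      = cumulantSum (P0 d α β) (hamiltonian s D κ (as 0) (Js 0)) t := by
  haveI : IsProbabilityMeasure (P0 d α β) := isProbabilityMeasure_P0 hα hβ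
  rw [cumulantSum_chain_telescope hα hβ hsupp hrecJ hreca t, hJn]
  have h0 : hamiltonian s D κ (as n) (∅ : Finset (B1Eq324BenfattoLemma.Site d)) = fun _ => 0 :=
    funext fun z => hamiltonian_empty (as n) z
  rw [h0, Literature.MathematicalPhysics.QuantumFieldTheory.Balaban1983to89.B1Eq324BenfattoSpecialisation.cumulantSum_zero, sub_zero]

end Telescope

end Literature.MathematicalPhysics.QuantumFieldTheory.Balaban1983to89.B1Eq324BenfattoSect5PavementChain

end
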